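import Literature.NumberTheory.GaloisCohomology.RestrictedRamificationExtComparisonLocalUnits
import Literature.NumberTheory.GaloisRepresentations.IdeleTruncatedSLocalInjectivity
import HarnessLib

/-!
# `Λ_v = cmp_v ∘ (idLocMap ·)_v`: the (Λ1) map `lambdaLoc` read through the permutation-dévissage localisation `idLocMap`,
# and hypothesis (Λ2) of `PoitouTateRestrictedShaTwoLocalCriterion` from the injectivity of `idLocMap` (Milne I Lemma 4.13)

Topic `NumberTheory/GaloisCohomology`; namespace `Literature.NumberTheory.GaloisCohomology.RestrictedExt`.  Theorems only (no def, no
named fact, no instance, no `sorry`).  Sequel of `RestrictedRamificationExtComparisonLocalUnits` (bsd-eis -w7 g13: `lambdaLoc`, `cmpLocal`,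
`idelePiLoc`, `hΛ1_lambdaLoc`) and of -w4 g20's `IdeleTruncatedSLocalInjectivity` (`IdeleReadout.idLocMap K S A n`, the `Place`-indexed
localisation `Extⁿ_{G_S}(A, Ī_S) → ∏_{w ∣ S ∪ ∞} Extⁿ_{Γ_{K_w}}(φ_w^* A, K̄_wˣ)`, with `idLocMap_injective_two_of_inputs`).

* `idLocMap_inr_eq` — at a finite place `v ∈ S` the `w = v` component of `idLocMap` IS the argument of `lambdaLoc`:
  `idLocMap K S A r z ⟨Sum.inr v, hv⟩ = φ_v^* z ∘ π_v^S` (the two local functors / projections agree definitionally);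
* `lambdaLoc_eq_cmpLocal_idLocMap` — `Λ_v z = cmp_v (idLocMap … z ⟨Sum.inr v, hv⟩)`;
* **`hΛ2_lambdaLoc_of_idLocMap_injective`** — if `idLocMap K S ⟨M^{N_S}⟩ 2` is injective and its archimedean components vanish
  identically (K totally complex), then `∀ z, (∀ v ∈ S, Λ_v z = 0) → z = 0`, i.e. hypothesis (Λ2) of
  `PoitouTateRestrictedShaTwoLocalCriterion` for `Λ := lambdaLoc` — so (Λ1) (`hΛ1_lambdaLoc`) and (Λ2) meet on the SAME `Λ`.
HONEST FRAMING: bookkeeping; the injectivity itself (Milne I Lemma 4.13 at `r = 2`) is the E3/E4 files of -w4 g20 and -w3 g18 and is NOT proved here; no duality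
theorem and no case of BSD is proved here.

## References
* J. S. Milne, *Arithmetic Duality Theorems*, 2nd ed. (2006), I §4 Lemma 4.13, proof of Thm. 4.10 (a) (p. 58). [MilneADT2006]
* D. Harari, *Galois Cohomology and Class Field Theory*, Universitext (2020), Prop. 17.25, Prop. 17.26. [Harari2020]
-/

noncomputable section

open CategoryTheory CategoryTheory.Abelian NumberField Field IsDedekindDomain
open Literature.Algebra.Homology Literature.Algebra.Homology.DiscreteRep
open Literature.NumberTheory.GaloisRepresentations
open scoped NumberField

namespace Literature.NumberTheory.GaloisCohomology

namespace RestrictedExt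

attribute [local instance] moduleFinite_pullD_quotientInvariants compactSpace_absoluteGaloisGroup_completion

variable (K : Type) [Field K] [NumberField K] (S : Finset (HeightOneSpectrum (𝓞 K))) (n : ℕ) [NeZero n]
  {M : Type} [AddCommGroup M] [TopologicalSpace M] [DiscreteTopology M] [Finite M] (ρ : DiscreteGaloisModule K M)
  (v : HeightOneSpectrum (𝓞 K))

omit [NeZero n] [Finite M] in
/-- **At a finite place `v ∈ S`, the `v`-component of `idLocMap` is `φ_v^* z ∘ π_v^S`** — the argument of `lambdaLoc` (the local
functor `locFun K S ⟨Sum.inr v, _⟩ = resDHom ℤ (decompMapPlaceS …) _` and `pullD ℤ (localizationHom K ↑S (Sum.inr v))`, and the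
projections `locQ`/`idelePiLoc`, agree definitionally). [cite: MilneADT2006, I Lemma 4.13][cite: Harari2020, Prop. 17.25] -/
theorem idLocMap_inr_eq (A : DiscreteRepCat ℤ (GaloisGroupUnramifiedOutside K (↑S : Set (HeightOneSpectrum (𝓞 K)))))
    (r : ℕ) (z : Ext A (IdeleClassBar.truncIdeleBarD K S) r) (hv : v ∈ S) :
    IdeleReadout.idLocMap K S A r z ⟨Sum.inr v, hv⟩ =
      (z.mapExactFunctor (pullD ℤ (localizationHom K (↑S : Set (HeightOneSpectrum (𝓞 K))) (Sum.inr v)))).comp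
        (Ext.mk₀ (idelePiLoc K S v)) (add_zero r) :=
  rfl

/-- **`Λ_v z = cmp_v ((idLocMap z)_v)`.** [cite: MilneADT2006, I Lemma 4.13][cite: Harari2020, Prop. 17.25, Prop. 17.26] -/
theorem lambdaLoc_eq_cmpLocal_idLocMap (hM : ∀ m : M, n • m = 0)
    (hur : ramificationSubgroup K (↑S : Set (HeightOneSpectrum (𝓞 K))) ≤ ContinuousRep.ker ρ) (r : ℕ)
    (z : Ext (ofContinuousRep (ρ.quotientInvariants (ramificationSubgroup K (↑S : Set (HeightOneSpectrum (𝓞 K))))))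
      (IdeleClassBar.truncIdeleBarD K S) r) (hv : v ∈ S) :
    lambdaLoc K S n ρ v hM hur r z =
      cmpLocal K S n ρ v hM hur r (IdeleReadout.idLocMap K S _ r z ⟨Sum.inr v, hv⟩) :=
  rfl

set_option maxRecDepth 16384 in
/-- **(Λ2) FOR `Λ := lambdaLoc` FROM THE INJECTIVITY OF `idLocMap`**: if `idLocMap K S ⟨M^{N_S}⟩ 2` is injective (Milne I Lemma 4.13
at `r = 2`, -w4's `idLocMap_injective_two_of_inputs`) and its archimedean components vanish identically (`harch0`; automatic for
`K` totally complex), then a class of `Ext²(⟨M^{N_S}⟩, Ī_S)` killed by every `Λ_v`, `v ∈ S`, is zero — hypothesis `hΛ2` of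
`exists_cmp_comp_extClass_eq_of_mem_shaRestricted'` verbatim for `Λ v hv := lambdaLoc K S n ρ v hM hur 2`.
[cite: MilneADT2006, I Lemma 4.13, Thm. 4.10 (a) (proof, p. 58)][cite: Harari2020, Prop. 17.25] -/
theorem hΛ2_lambdaLoc_of_idLocMap_injective (hM : ∀ m : M, n • m = 0)
    (hur : ramificationSubgroup K (↑S : Set (HeightOneSpectrum (𝓞 K))) ≤ ContinuousRep.ker ρ)
    (hinj : Function.Injective (IdeleReadout.idLocMap K S
      (ofContinuousRep (ρ.quotientInvariants (ramificationSubgroup K (↑S : Set (HeightOneSpectrum (𝓞 K)))))) 2))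
    (harch0 : ∀ (z : Ext (ofContinuousRep (ρ.quotientInvariants (ramificationSubgroup K (↑S : Set (HeightOneSpectrum (𝓞 K))))))
        (IdeleClassBar.truncIdeleBarD K S) 2) (u : InfinitePlace K),
      IdeleReadout.idLocMap K S _ 2 z ⟨Sum.inl u, trivial⟩ = 0) :
    ∀ z : Ext (ofContinuousRep (ρ.quotientInvariants (ramificationSubgroup K (↑S : Set (HeightOneSpectrum (𝓞 K))))))
        (IdeleClassBar.truncIdeleBarD K S) 2,
      (∀ (v : HeightOneSpectrum (𝓞 K)) (hv : v ∈ (↑S : Set (HeightOneSpectrum (𝓞 K)))),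
        lambdaLoc K S n ρ v hM hur 2 z = 0) → z = 0 := by
  intro z hz
  apply hinj
  rw [map_zero]
  funext w
  rw [Pi.zero_apply]
  obtain ⟨w, hw⟩ := w
  cases w with
  | inl u => exact harch0 z u
  | inr v' =>
    have hv' : v' ∈ S := hw
    -- `Λ_{v'} z = cmp_{v'} ((idLocMap z)_{v'})` definitionally (`lambdaLoc_eq_cmpLocal_idLocMap`), and `cmp_{v'}` is injective
    have h := hz v' (Finset.mem_coe.2 hv')
    rw [lambdaLoc_eq_cmpLocal_idLocMap K S n ρ v' hM hur 2 z hv'] at h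
    exact (AddEquiv.map_eq_zero_iff (cmpLocal K S n ρ v' hM hur 2)).1 h

end RestrictedExt

end Literature.NumberTheory.GaloisCohomology

end
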